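import Literature.Computability.AlgebraicComplexity.GlobalStagePresent
import HarnessLib

/-!
# More asymmetric hashing in the paper's coordinates: `X`-survival, its probability, and the block
triples of `𝒯_hash` (Alman–Duan–Vassilevska Williams–Xu–Xu–Zhou 2025, §5.2, Lemma 5.5) — proved

Topic `Literature/Computability/AlgebraicComplexity`.  §5.2 "More Asymmetric Hashing" of Alman–Duan–
Vassilevska Williams–Xu–Xu–Zhou, *More asymmetry yields faster matrix multiplication* (SODA 2025,
arXiv:2404.16349) uses the hash functions `h_X, h_Y, h_Z` and the Salem–Spencer bucket set `B` of
Vassilevska Williams–Xu–Xu–Zhou 2024 (`AsymmetricHashing.lean`: seeds `VxxzSeed M n`, `vxxzHashX/Y/Z`;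
`AsymmetricCleanup.lean`: `InBucket`, `Survives`; `GlobalStagePresent.lean`: `hashPresent`, `keptX`,
`keptZ`, `presentTriples`) but cleans the buckets in ONE dimension only:

> Now for every `b ∈ B`, if there are two block triples `X_I Y_J Z_K` and `X_I Y_{J'} Z_{K'}` that are
> both hashed to `b` and share the same `X`-block `X_I`, we zero out `X_I`.  We call the tensor after
> this zeroing out `𝒯_hash` and note that every level-`ℓ` `X`-block is in a unique level-`ℓ` block triple
> in `𝒯_hash`.  We highlight the fact that this is the start of the main deviation from previous works.
>
> **Lemma 5.5** (2) For every `b ∈ B` and every level-`ℓ` block triple `X_I Y_J Z_K ∈ 𝒯` consistent with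
> `α`, `Pr[X_I Y_J Z_K ∈ 𝒯_hash | h_X(I) = h_Y(J) = h_Z(K) = b] ≥ 3/4`.  (3)
> `E[number of level-ℓ triples in 𝒯_hash] ≥ 𝒩_α · M₀^{-1-o(1)}`.

(`M₀ ≥ 8 · numtriple/numxblock`, eq. (M₀); item (1) of the lemma is `card_seeds_inBucket` /
`card_seeds_inBucket_shareX` of `AsymmetricCleanup.lean`.)  `MoreAsymmetricHashing.lean` proved the
OUTCOME of (2)–(3) in the abstract coordinates of Bürgisser–Clausen–Shokrollahi Thm. 15.39; this file
proves the lemma itself, as exact counting statements over the seed space, in the coordinates of the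
tree's VXXZ global stage, so that the structural files of the ADVXXZ global stage can be built on
`GlobalStagePresent.lean` / `GlobalStageStructure.lean`:

* `XSurvives 𝒯 ω T b` — `T` lies in bucket `b` and no OTHER triple of `𝒯` sharing its `X`-block does
  (the VXXZ event `Survives` — no `X`- and no `Y`-collision — implies it, `Survives.xSurvives`);
* `advxxz2025_lemma55_survival` — **Lemma 5.5 (2)**, indeed with `7/8` in place of `3/4` since only
  the `X`-collisions are charged: `8 |𝒯| ≤ M |typeClass n μX|` (`M ≥ 8 numtriple/numxblock`), `M` an
  odd prime `> P`, `n ≥ 1` ⇒ `7 M^n ≤ 8 · #{ω | XSurvives 𝒯 ω T b}` for every `T ∈ 𝒯` and bucket `b`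
  (`#{ω | T in bucket b} = M^n`); `advxxz2025_lemma55_survival_three_quarters` — the printed `≥ 3/4`;
* `advxxz2025_lemma55_expectation`, `advxxz2025_lemma55_exists` — **Lemma 5.5 (3)** summed over any
  `𝒯α ⊆ 𝒯` and the buckets of `B`: `7 |B| |𝒯α| M^n ≤ 8 ∑_ω #{(b,T) ∈ B × 𝒯α | XSurvives}`, and some seed
  attains the expectation, `7 |B| |𝒯α| ≤ 8 M² · #{T ∈ 𝒯α | X-survives in some b ∈ B}`;
* `xKeptY`, `xPresentTriples` — **the block triples of `𝒯_hash`**: `X`-block kept (`keptX`: hashed into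
  `B`, in a unique hash-present triple, that triple consistent with `α`), `Y`- and `Z`-blocks merely
  hashed into `B` (shared); PROVED: distinct triples of `𝒯_hash` have distinct `X`-blocks
  (`xPresentTriples_eq_of_fst_eq`), they are consistent with `α` (`xPresentTriples_subset`), VXXZ's
  `𝒯'` is contained in `𝒯_hash` (`presentTriples_subset_xPresentTriples`), and for `B` without 3-term
  progressions **the triples of `𝒯_hash` are exactly the `α`-consistent `X`-survivors**
  (`xPresentTriples_eq_filter_xSurvives`).

Everything is proved; the definitions are the event and the two filters; no named facts.

## References

* J. Alman, R. Duan, V. Vassilevska Williams, Y. Xu, Z. Xu, R. Zhou, *More asymmetry yields faster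
  matrix multiplication*, SODA 2025, arXiv:2404.16349 (held: `paper:arxiv-2404.16349`, chunk p0016):
  §5.2, eq. (M₀), the definition of `𝒯_hash`, Lemma 5.5. [AlmanDuanVassilevskaWilliamsXuXuZhou2025]
* V. Vassilevska Williams, Y. Xu, Z. Xu, R. Zhou, *New bounds for matrix multiplication: from alpha
  to omega*, SODA 2024, arXiv:2307.07970, §5.2, Claims 5.5–5.7 (the two-dimensional cleanup).
  [VassilevskaWilliamsXuXuZhou2024]
-/

open scoped BigOperators
open Finset

namespace Literature.Computability.AlgebraicComplexity

/-! ## `X`-survival of a triple under the more asymmetric cleanup -/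

section XSurvival

variable {M : ℕ} {n P : ℕ}

/-- **`X`-survival of `T` in bucket `b`**: `T` lies in bucket `b`, and no OTHER triple of `𝒯` sharing
its `X`-block lies in bucket `b` (then `X_I` is in a unique triple of its bucket and is kept; for `T`
consistent with `α`, `T ∈ 𝒯_hash`). [cite: AlmanDuanVassilevskaWilliamsXuXuZhou2025, §5.2 (definition of 𝒯_hash)] -/
def XSurvives (𝒯 : Finset ((Fin n → Fin (P + 1)) × (Fin n → Fin (P + 1)) × (Fin n → Fin (P + 1))))
    (ω : VxxzSeed M n) (T : (Fin n → Fin (P + 1)) × (Fin n → Fin (P + 1)) × (Fin n → Fin (P + 1)))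
    (b : ZMod M) : Prop :=
  InBucket P ω T b ∧ ∀ T' ∈ 𝒯, T' ≠ T → T'.1 = T.1 → ¬ InBucket P ω T' b

/-- `X`-survival is decidable (classically; only counts are used). [folklore] -/
noncomputable instance XSurvives.decidable
    (𝒯 : Finset ((Fin n → Fin (P + 1)) × (Fin n → Fin (P + 1)) × (Fin n → Fin (P + 1))))
    (ω : VxxzSeed M n) (T : (Fin n → Fin (P + 1)) × (Fin n → Fin (P + 1)) × (Fin n → Fin (P + 1)))
    (b : ZMod M) : Decidable (XSurvives 𝒯 ω T b) := Classical.dec _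

/-- The two-dimensional survival of VXXZ 2024 implies `X`-survival. [cite: AlmanDuanVassilevskaWilliamsXuXuZhou2025, §5.2 ("in [DWZ23, VXXZ24], after this step all level-ℓ X-blocks and Y-blocks are in unique block triples")] -/
theorem Survives.xSurvives {𝒯 : Finset ((Fin n → Fin (P + 1)) × (Fin n → Fin (P + 1)) × (Fin n → Fin (P + 1)))}
    {ω : VxxzSeed M n} {T : (Fin n → Fin (P + 1)) × (Fin n → Fin (P + 1)) × (Fin n → Fin (P + 1))}
    {b : ZMod M} (h : Survives 𝒯 ω T b) : XSurvives 𝒯 ω T b :=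
  ⟨h.1, h.2.1⟩

/-- A triple `X`-survives in at most one bucket (its bucket is `h_X(I)`), so the number of pairs
`(b, T) ∈ B × 𝒯α` with `T` `X`-surviving in `b` is the number of `T ∈ 𝒯α` `X`-surviving in SOME
`b ∈ B`. [cite: AlmanDuanVassilevskaWilliamsXuXuZhou2025, §5.2] -/
theorem card_filter_product_xSurvives_eq
    (𝒯 𝒯α : Finset ((Fin n → Fin (P + 1)) × (Fin n → Fin (P + 1)) × (Fin n → Fin (P + 1))))
    (B : Finset (ZMod M)) (ω : VxxzSeed M n) :
    ((B ×ˢ 𝒯α).filter fun bT => XSurvives 𝒯 ω bT.2 bT.1).card =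
      (𝒯α.filter fun T => ∃ b ∈ B, XSurvives 𝒯 ω T b).card := by
  classical
  refine card_bij (fun bT _ => bT.2) (fun bT hbT => ?_) (fun bT₁ h₁ bT₂ h₂ h => ?_) (fun T hT => ?_)
  · rw [mem_filter, mem_product] at hbT
    exact mem_filter.2 ⟨hbT.1.2, bT.1, hbT.1.1, hbT.2⟩
  · rw [mem_filter] at h₁ h₂
    have hb : bT₁.1 = bT₂.1 := by
      have e1 := h₁.2.1.1
      have e2 := h₂.2.1.1
      rw [h] at e1
      exact e1.symm.trans e2
    exact Prod.ext hb h
  · rw [mem_filter] at hT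
    obtain ⟨hT, b, hb, hs⟩ := hT
    exact ⟨(b, T), mem_filter.2 ⟨mem_product.2 ⟨hb, hT⟩, hs⟩, rfl⟩

variable [Fact M.Prime]

/-- **ADVXXZ Lemma 5.5 (2)** (survival probability, counting form, sharp constant).  Let `𝒯` be the
block triples with marginal types `μX, μY, μZ`, `M` an odd prime with `P < M` and
`8 |𝒯| ≤ M · |typeClass n μX|` (the requirement `M ≥ M₀ ≥ 8 · numtriple/numxblock`, eq. (M₀)).  Then
for every `T ∈ 𝒯` and every bucket `b`, at least `7/8` of the `M^n` seeds that put `T` into bucket `b`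
let it `X`-survive: `7 M^n ≤ 8 · #{ω | XSurvives 𝒯 ω T b}` (only the `X`-collisions, each of
probability `1/M`, are charged). [cite: AlmanDuanVassilevskaWilliamsXuXuZhou2025, Lemma 5.5 (2)] -/
theorem advxxz2025_lemma55_survival (hM : M ≠ 2) (hPM : P < M) (hn : 0 < n) {μX μY μZ : Fin (P + 1) → ℕ}
    (h8X : 8 * (typedSupport (levelSupport P) n μX μY μZ).card ≤ M * (typeClass n μX).card)
    {T : (Fin n → Fin (P + 1)) × (Fin n → Fin (P + 1)) × (Fin n → Fin (P + 1))}
    (hT : T ∈ typedSupport (levelSupport P) n μX μY μZ) (b : ZMod M) :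
    7 * M ^ n ≤ 8 * (univ.filter fun ω : VxxzSeed M n =>
      XSurvives (typedSupport (levelSupport P) n μX μY μZ) ω T b).card := by
  classical
  set 𝒯 := typedSupport (levelSupport P) n μX μY μZ with h𝒯
  obtain ⟨hIμ, -, -, -⟩ := mem_typedSupport.1 hT
  -- the seeds with `T` in bucket `b` split into `X`-survivors and `X`-collisions
  set S := univ.filter fun ω : VxxzSeed M n => XSurvives 𝒯 ω T b with hS
  set CX := univ.filter fun ω : VxxzSeed M n =>
    InBucket P ω T b ∧ ∃ T' ∈ 𝒯, T' ≠ T ∧ T'.1 = T.1 ∧ InBucket P ω T' b with hCX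
  have hcover : (univ.filter fun ω : VxxzSeed M n => InBucket P ω T b) ⊆ S ∪ CX := by
    intro ω hω
    rw [mem_filter] at hω
    rw [mem_union, hS, hCX, mem_filter, mem_filter]
    by_cases hx : ∃ T' ∈ 𝒯, T' ≠ T ∧ T'.1 = T.1 ∧ InBucket P ω T' b
    · exact Or.inr ⟨mem_univ _, hω.2, hx⟩
    exact Or.inl ⟨mem_univ _, hω.2, fun T' hT' hne h1 hb => hx ⟨T', hT', hne, h1, hb⟩⟩
  have hbucket : (univ.filter fun ω : VxxzSeed M n => InBucket P ω T b).card = M ^ n :=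
    card_seeds_inBucket hM hT b
  -- union bound for the `X`-collisions
  have hCXle : CX.card ≤ ((𝒯.filter fun T' => T'.1 = T.1).card - 1) * M ^ (n - 1) := by
    have hsub : CX ⊆ ((𝒯.filter fun T' => T'.1 = T.1).erase T).biUnion fun T' =>
        univ.filter fun ω : VxxzSeed M n => InBucket P ω T b ∧ InBucket P ω T' b := by
      intro ω hω
      rw [hCX, mem_filter] at hω
      obtain ⟨-, hb, T', hT', hne, h1, hb'⟩ := hω
      rw [mem_biUnion]
      exact ⟨T', mem_erase.2 ⟨hne, mem_filter.2 ⟨hT', h1⟩⟩, mem_filter.2 ⟨mem_univ _, hb, hb'⟩⟩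
    refine (card_le_card hsub).trans (card_biUnion_le.trans ?_)
    have hTmem : T ∈ 𝒯.filter (fun T' => T'.1 = T.1) := mem_filter.2 ⟨hT, rfl⟩
    rw [← card_erase_of_mem hTmem, ← smul_eq_mul, ← sum_const]
    refine sum_le_sum fun T' hT' => ?_
    obtain ⟨hne, hT'⟩ := mem_erase.1 hT'
    obtain ⟨hT'𝒯, h1⟩ := mem_filter.1 hT'
    exact (card_seeds_inBucket_shareX hM hPM hn hT hT'𝒯 hne h1 b).le
  -- the degree is `numtriple/numxblock ≤ M/8`
  have hdegX : 8 * (𝒯.filter fun T' => T'.1 = T.1).card ≤ M := by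
    have hpos : 0 < (typeClass n μX).card := card_pos.2 ⟨T.1, mem_typeClass.2 hIμ⟩
    refine Nat.le_of_mul_le_mul_right ?_ hpos
    calc 8 * (𝒯.filter fun T' => T'.1 = T.1).card * (typeClass n μX).card = 8 * 𝒯.card := by
          rw [mul_assoc, degX_mul_card_typeClass hIμ]
      _ ≤ M * (typeClass n μX).card := h8X
  have hpow : M ^ (n - 1) * M = M ^ n := by
    rw [← pow_succ]; congr 1; omega
  have hCX8 : 8 * CX.card ≤ M ^ n := by
    calc 8 * CX.card ≤ 8 * (((𝒯.filter fun T' => T'.1 = T.1).card - 1) * M ^ (n - 1)) :=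
          Nat.mul_le_mul_left _ hCXle
      _ ≤ 8 * ((𝒯.filter fun T' => T'.1 = T.1).card * M ^ (n - 1)) :=
          Nat.mul_le_mul_left _ (Nat.mul_le_mul_right _ (Nat.sub_le _ _))
      _ = 8 * (𝒯.filter fun T' => T'.1 = T.1).card * M ^ (n - 1) := by ring
      _ ≤ M * M ^ (n - 1) := Nat.mul_le_mul_right _ hdegX
      _ = M ^ n := by rw [mul_comm, hpow]
  -- assemble: `M^n ≤ |S| + |CX|`
  have hle : M ^ n ≤ S.card + CX.card := by
    rw [← hbucket]
    exact (card_le_card hcover).trans (card_union_le _ _)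
  omega

/-- **Lemma 5.5 (2) as printed**: the survival probability is `≥ 3/4`, i.e.
`3 M^n ≤ 4 · #{ω | XSurvives 𝒯 ω T b}`. [cite: AlmanDuanVassilevskaWilliamsXuXuZhou2025, Lemma 5.5 (2)] -/
theorem advxxz2025_lemma55_survival_three_quarters (hM : M ≠ 2) (hPM : P < M) (hn : 0 < n)
    {μX μY μZ : Fin (P + 1) → ℕ}
    (h8X : 8 * (typedSupport (levelSupport P) n μX μY μZ).card ≤ M * (typeClass n μX).card)
    {T : (Fin n → Fin (P + 1)) × (Fin n → Fin (P + 1)) × (Fin n → Fin (P + 1))}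
    (hT : T ∈ typedSupport (levelSupport P) n μX μY μZ) (b : ZMod M) :
    3 * M ^ n ≤ 4 * (univ.filter fun ω : VxxzSeed M n =>
      XSurvives (typedSupport (levelSupport P) n μX μY μZ) ω T b).card := by
  have := advxxz2025_lemma55_survival hM hPM hn h8X hT b
  omega

/-- **ADVXXZ Lemma 5.5 (3)** (expected number of triples of `𝒯_hash`, counting form): summing (2) over
the triples of any `𝒯α ⊆ 𝒯` (those consistent with `α`) and the buckets `b ∈ B`,
`7 · |B| · |𝒯α| · M^n ≤ 8 · ∑_ω #{(b, T) ∈ B × 𝒯α | XSurvives 𝒯 ω T b}` — dividing by `|Ω| = M^{n+2}`,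
the expected number of `α`-consistent triples `X`-surviving in a bucket of `B` is
`≥ (7/8) |B| |𝒯α| / M²` (`= 𝒩_α · |B| · M^{-2} · (7/8) = 𝒩_α · M₀^{-1-o(1)}` for the Salem–Spencer `B`).
[cite: AlmanDuanVassilevskaWilliamsXuXuZhou2025, Lemma 5.5 (3)] -/
theorem advxxz2025_lemma55_expectation (hM : M ≠ 2) (hPM : P < M) (hn : 0 < n) {μX μY μZ : Fin (P + 1) → ℕ}
    (h8X : 8 * (typedSupport (levelSupport P) n μX μY μZ).card ≤ M * (typeClass n μX).card)
    {𝒯α : Finset ((Fin n → Fin (P + 1)) × (Fin n → Fin (P + 1)) × (Fin n → Fin (P + 1)))}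
    (h𝒯α : 𝒯α ⊆ typedSupport (levelSupport P) n μX μY μZ) (B : Finset (ZMod M)) :
    7 * (B.card * 𝒯α.card * M ^ n) ≤ 8 * ∑ ω : VxxzSeed M n,
      ((B ×ˢ 𝒯α).filter fun bT => XSurvives (typedSupport (levelSupport P) n μX μY μZ) ω bT.2 bT.1).card := by
  classical
  have hswap : ∑ ω : VxxzSeed M n,
      ((B ×ˢ 𝒯α).filter fun bT => XSurvives (typedSupport (levelSupport P) n μX μY μZ) ω bT.2 bT.1).card =
      ∑ bT ∈ B ×ˢ 𝒯α, (univ.filter fun ω : VxxzSeed M n =>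
        XSurvives (typedSupport (levelSupport P) n μX μY μZ) ω bT.2 bT.1).card := by
    simp only [card_filter]
    rw [sum_comm]
  rw [hswap, mul_sum]
  calc 7 * (B.card * 𝒯α.card * M ^ n) = ∑ _bT ∈ B ×ˢ 𝒯α, 7 * M ^ n := by
        rw [sum_const, card_product, smul_eq_mul]; ring
    _ ≤ ∑ bT ∈ B ×ˢ 𝒯α, 8 * (univ.filter fun ω : VxxzSeed M n =>
          XSurvives (typedSupport (levelSupport P) n μX μY μZ) ω bT.2 bT.1).card :=
        sum_le_sum fun bT hbT => advxxz2025_lemma55_survival hM hPM hn h8X (h𝒯α (mem_product.1 hbT).2) bT.1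

/-- **Lemma 5.5 (3), existence of a good seed**: some choice of the hash functions keeps at least the
expected number of `α`-consistent triples in `𝒯_hash`:
`∃ ω, 7 |B| |𝒯α| ≤ 8 M² · #{T ∈ 𝒯α | T X-survives in some bucket b ∈ B}`.
[cite: AlmanDuanVassilevskaWilliamsXuXuZhou2025, Lemma 5.5 (3)] -/
theorem advxxz2025_lemma55_exists (hM : M ≠ 2) (hPM : P < M) (hn : 0 < n) {μX μY μZ : Fin (P + 1) → ℕ}
    (h8X : 8 * (typedSupport (levelSupport P) n μX μY μZ).card ≤ M * (typeClass n μX).card)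
    {𝒯α : Finset ((Fin n → Fin (P + 1)) × (Fin n → Fin (P + 1)) × (Fin n → Fin (P + 1)))}
    (h𝒯α : 𝒯α ⊆ typedSupport (levelSupport P) n μX μY μZ) (B : Finset (ZMod M)) :
    ∃ ω : VxxzSeed M n, 7 * (B.card * 𝒯α.card) ≤ 8 * M ^ 2 *
      (𝒯α.filter fun T => ∃ b ∈ B, XSurvives (typedSupport (levelSupport P) n μX μY μZ) ω T b).card := by
  classical
  have hsum := advxxz2025_lemma55_expectation hM hPM hn h8X h𝒯α B
  simp only [card_filter_product_xSurvives_eq] at hsum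
  by_contra hcon
  simp only [not_exists, not_le] at hcon
  have hlt : ∑ ω : VxxzSeed M n, 8 * M ^ 2 *
      (𝒯α.filter fun T => ∃ b ∈ B, XSurvives (typedSupport (levelSupport P) n μX μY μZ) ω T b).card <
      ∑ _ω : VxxzSeed M n, 7 * (B.card * 𝒯α.card) :=
    sum_lt_sum_of_nonempty univ_nonempty fun ω _ => hcon ω
  rw [sum_const, card_univ, card_vxxzSeed, smul_eq_mul, ← mul_sum] at hlt
  have : M ^ (n + 2) * (7 * (B.card * 𝒯α.card)) ≤ 8 * M ^ 2 *
      ∑ ω : VxxzSeed M n, (𝒯α.filter fun T => ∃ b ∈ B,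
        XSurvives (typedSupport (levelSupport P) n μX μY μZ) ω T b).card := by
    calc M ^ (n + 2) * (7 * (B.card * 𝒯α.card)) = M ^ 2 * (7 * (B.card * 𝒯α.card * M ^ n)) := by ring
      _ ≤ M ^ 2 * (8 * ∑ ω : VxxzSeed M n,
          (𝒯α.filter fun T => ∃ b ∈ B, XSurvives (typedSupport (levelSupport P) n μX μY μZ) ω T b).card) :=
          Nat.mul_le_mul_left _ hsum
      _ = _ := by ring
  exact absurd (lt_of_le_of_lt this hlt) (lt_irrefl _)

end XSurvival

/-! ## The block triples of `𝒯_hash` -/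

section Present

variable {M : ℕ} {n P : ℕ}

/-- **The level-`ℓ` `Y`-blocks kept by the more asymmetric hashing**: those hashed into `B` (the
cleanup removes `X`-blocks only; `Y`-blocks are shared). [cite: AlmanDuanVassilevskaWilliamsXuXuZhou2025, §5.2 ("we zero out … all the level-ℓ Y-blocks Y_J where h_Y(J) ∉ B")] -/
noncomputable def xKeptY (P : ℕ) (𝒯 : Finset ((Fin n → Fin (P + 1)) × (Fin n → Fin (P + 1)) × (Fin n → Fin (P + 1))))
    (ω : VxxzSeed M n) (B : Finset (ZMod M)) : Finset (Fin n → Fin (P + 1)) := by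
  classical
  exact (𝒯.image fun T => T.2.1).filter fun J => vxxzHashY ω (seqVal J) ∈ B

/-- **The block triples of `𝒯_hash`**: those of `𝒯` whose `X`-block is kept by the cleanup (`keptX`:
hashed into `B`, in a unique hash-present triple, that triple consistent with `α`) and whose `Y`- and
`Z`-blocks are hashed into `B`. [cite: AlmanDuanVassilevskaWilliamsXuXuZhou2025, §5.2 (definition of 𝒯_hash)] -/
noncomputable def xPresentTriples (P : ℕ)
    (𝒯 𝒯α : Finset ((Fin n → Fin (P + 1)) × (Fin n → Fin (P + 1)) × (Fin n → Fin (P + 1))))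
    (ω : VxxzSeed M n) (B : Finset (ZMod M)) :
    Finset ((Fin n → Fin (P + 1)) × (Fin n → Fin (P + 1)) × (Fin n → Fin (P + 1))) := by
  classical
  exact 𝒯.filter fun T => T.1 ∈ keptX P 𝒯 𝒯α ω B ∧ T.2.1 ∈ xKeptY P 𝒯 ω B ∧ T.2.2 ∈ keptZ P 𝒯 ω B

/-- Membership in `xKeptY`. [cite: AlmanDuanVassilevskaWilliamsXuXuZhou2025, §5.2] -/
theorem mem_xKeptY {𝒯 : Finset ((Fin n → Fin (P + 1)) × (Fin n → Fin (P + 1)) × (Fin n → Fin (P + 1)))}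
    {ω : VxxzSeed M n} {B : Finset (ZMod M)} {J : Fin n → Fin (P + 1)} :
    J ∈ xKeptY P 𝒯 ω B ↔ (∃ T ∈ 𝒯, T.2.1 = J) ∧ vxxzHashY ω (seqVal J) ∈ B := by
  classical
  simp only [xKeptY, mem_filter, mem_image]

/-- Membership in `xPresentTriples`. [cite: AlmanDuanVassilevskaWilliamsXuXuZhou2025, §5.2] -/
theorem mem_xPresentTriples
    {𝒯 𝒯α : Finset ((Fin n → Fin (P + 1)) × (Fin n → Fin (P + 1)) × (Fin n → Fin (P + 1)))}
    {ω : VxxzSeed M n} {B : Finset (ZMod M)}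
    {T : (Fin n → Fin (P + 1)) × (Fin n → Fin (P + 1)) × (Fin n → Fin (P + 1))} :
    T ∈ xPresentTriples P 𝒯 𝒯α ω B ↔
      T ∈ 𝒯 ∧ T.1 ∈ keptX P 𝒯 𝒯α ω B ∧ T.2.1 ∈ xKeptY P 𝒯 ω B ∧ T.2.2 ∈ keptZ P 𝒯 ω B := by
  classical
  simp only [xPresentTriples, mem_filter]

/-- A VXXZ-kept `Y`-block is hashed into `B`, hence kept by the more asymmetric hashing. [cite: AlmanDuanVassilevskaWilliamsXuXuZhou2025, §5.2] -/
theorem keptY_subset_xKeptY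
    (𝒯 𝒯α : Finset ((Fin n → Fin (P + 1)) × (Fin n → Fin (P + 1)) × (Fin n → Fin (P + 1))))
    (ω : VxxzSeed M n) (B : Finset (ZMod M)) : keptY P 𝒯 𝒯α ω B ⊆ xKeptY P 𝒯 ω B := by
  intro J hJ
  obtain ⟨hJ𝒯, hJB, -⟩ := mem_keptY.1 hJ
  exact mem_xKeptY.2 ⟨hJ𝒯, hJB⟩

/-- **VXXZ's `𝒯'` is contained in ADVXXZ's `𝒯_hash`** (the two-dimensional cleanup removes more).
[cite: AlmanDuanVassilevskaWilliamsXuXuZhou2025, §5.2 ("In comparison with previous works …")] -/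
theorem presentTriples_subset_xPresentTriples
    (𝒯 𝒯α : Finset ((Fin n → Fin (P + 1)) × (Fin n → Fin (P + 1)) × (Fin n → Fin (P + 1))))
    (ω : VxxzSeed M n) (B : Finset (ZMod M)) : presentTriples P 𝒯 𝒯α ω B ⊆ xPresentTriples P 𝒯 𝒯α ω B := by
  intro T hT
  obtain ⟨hT𝒯, hx, hy, hz⟩ := mem_presentTriples.1 hT
  exact mem_xPresentTriples.2 ⟨hT𝒯, hx, keptY_subset_xKeptY 𝒯 𝒯α ω B hy, hz⟩

/-- A triple of `𝒯_hash` is hash-present. [cite: AlmanDuanVassilevskaWilliamsXuXuZhou2025, §5.2] -/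
theorem hashPresent_of_mem_xPresentTriples
    {𝒯 𝒯α : Finset ((Fin n → Fin (P + 1)) × (Fin n → Fin (P + 1)) × (Fin n → Fin (P + 1)))}
    {ω : VxxzSeed M n} {B : Finset (ZMod M)}
    {T : (Fin n → Fin (P + 1)) × (Fin n → Fin (P + 1)) × (Fin n → Fin (P + 1))}
    (hT : T ∈ xPresentTriples P 𝒯 𝒯α ω B) : T ∈ hashPresent P 𝒯 ω B := by
  obtain ⟨hT𝒯, hx, hy, hz⟩ := mem_xPresentTriples.1 hT
  exact mem_hashPresent.2 ⟨hT𝒯, (mem_keptX.1 hx).2.1, (mem_xKeptY.1 hy).2, (mem_keptZ.1 hz).2⟩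

/-- **Distinct triples of `𝒯_hash` have distinct `X`-blocks** ("every level-`ℓ` `X`-block is in a
unique level-`ℓ` block triple in `𝒯_hash`"). [cite: AlmanDuanVassilevskaWilliamsXuXuZhou2025, §5.2] -/
theorem xPresentTriples_eq_of_fst_eq
    {𝒯 𝒯α : Finset ((Fin n → Fin (P + 1)) × (Fin n → Fin (P + 1)) × (Fin n → Fin (P + 1)))}
    {ω : VxxzSeed M n} {B : Finset (ZMod M)}
    {T T' : (Fin n → Fin (P + 1)) × (Fin n → Fin (P + 1)) × (Fin n → Fin (P + 1))}
    (hT : T ∈ xPresentTriples P 𝒯 𝒯α ω B) (hT' : T' ∈ xPresentTriples P 𝒯 𝒯α ω B) (h : T.1 = T'.1) :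
    T = T' :=
  hashPresent_unique_of_mem_keptX (mem_xPresentTriples.1 hT).2.1 (hashPresent_of_mem_xPresentTriples hT)
    (hashPresent_of_mem_xPresentTriples hT') rfl h.symm

/-- The triples of `𝒯_hash` are consistent with `α` (the `α`-check on the unique triple of a kept
`X`-block). [cite: AlmanDuanVassilevskaWilliamsXuXuZhou2025, Lemma 5.5 (2)–(3) (triples "consistent with α")] -/
theorem xPresentTriples_subset
    {𝒯 𝒯α : Finset ((Fin n → Fin (P + 1)) × (Fin n → Fin (P + 1)) × (Fin n → Fin (P + 1)))}
    {ω : VxxzSeed M n} {B : Finset (ZMod M)} : xPresentTriples P 𝒯 𝒯α ω B ⊆ 𝒯α := by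
  intro T hT
  have hTp := hashPresent_of_mem_xPresentTriples hT
  obtain ⟨-, hx, -, -⟩ := mem_xPresentTriples.1 hT
  obtain ⟨-, -, T₀, hT₀α, hT₀p, hT₀I, hu⟩ := mem_keptX.1 hx
  rw [hu T hTp rfl]
  rwa [← hu T₀ hT₀p hT₀I]

/-- The triples of `𝒯_hash` lie in `𝒯`. [cite: AlmanDuanVassilevskaWilliamsXuXuZhou2025, §5.2] -/
theorem xPresentTriples_subset_tripleSet
    {𝒯 𝒯α : Finset ((Fin n → Fin (P + 1)) × (Fin n → Fin (P + 1)) × (Fin n → Fin (P + 1)))}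
    {ω : VxxzSeed M n} {B : Finset (ZMod M)} : xPresentTriples P 𝒯 𝒯α ω B ⊆ 𝒯 := fun _ hT =>
  (mem_xPresentTriples.1 hT).1

variable [Fact M.Prime]

/-- **The triples of `𝒯_hash` are exactly the `α`-consistent `X`-survivors in the buckets of `B`**
(for `B` without non-trivial 3-term progressions and `M` an odd prime): the event of Lemma 5.5 (2)–(3)
(`XSurvives`) is membership in `𝒯_hash`. [cite: AlmanDuanVassilevskaWilliamsXuXuZhou2025, §5.2 and Lemma 5.5] -/
theorem xPresentTriples_eq_filter_xSurvives (hM : M ≠ 2) {μX μY μZ : Fin (P + 1) → ℕ}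
    {𝒯α : Finset ((Fin n → Fin (P + 1)) × (Fin n → Fin (P + 1)) × (Fin n → Fin (P + 1)))}
    (h𝒯α : 𝒯α ⊆ typedSupport (levelSupport P) n μX μY μZ) (ω : VxxzSeed M n) {B : Finset (ZMod M)}
    (hB : ThreeAPFree (B : Set (ZMod M))) :
    xPresentTriples P (typedSupport (levelSupport P) n μX μY μZ) 𝒯α ω B =
      𝒯α.filter fun T => ∃ b ∈ B, XSurvives (typedSupport (levelSupport P) n μX μY μZ) ω T b := by
  classical
  set 𝒯 := typedSupport (levelSupport P) n μX μY μZ with h𝒯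
  ext T
  rw [mem_xPresentTriples, mem_filter, mem_keptX, mem_xKeptY, mem_keptZ]
  constructor
  · rintro ⟨hT, ⟨-, hXB, T₁, hT₁α, hT₁p, hT₁I, huX⟩, ⟨-, hYB⟩, -, hZB⟩
    have hTp : T ∈ hashPresent P 𝒯 ω B := mem_hashPresent.2 ⟨hT, hXB, hYB, hZB⟩
    have hT1 : T = T₁ := huX T hTp rfl
    refine ⟨hT1 ▸ hT₁α, vxxzHashX ω (seqVal T.1), hXB, inBucket_of_mem_hashPresent hM hB hTp, ?_⟩
    intro T' hT' hne h1 hb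
    exact hne ((huX T' (mem_hashPresent_of_inBucket hXB hT' hb) h1).trans hT1.symm)
  · rintro ⟨hTα, b, hb, hin, huX⟩
    have hT : T ∈ 𝒯 := h𝒯α hTα
    have hTp : T ∈ hashPresent P 𝒯 ω B := mem_hashPresent_of_inBucket hb hT hin
    obtain ⟨hXb, hYb, hZb⟩ := hin
    have hbX : b = vxxzHashX ω (seqVal T.1) := hXb.symm
    refine ⟨hT, ⟨⟨T, hT, rfl⟩, by rw [hXb]; exact hb, T, hTα, hTp, rfl, fun T' hT'p h1 => ?_⟩,
      ⟨⟨T, hT, rfl⟩, by rw [hYb]; exact hb⟩, ⟨T, hT, rfl⟩, by rw [hZb]; exact hb⟩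
    by_contra hne
    have hin' := inBucket_of_mem_hashPresent hM hB hT'p
    rw [h1, ← hbX] at hin'
    exact huX T' (mem_hashPresent.1 hT'p).1 hne h1 hin'

/-- Hence Lemma 5.5 (3) counts the triples of `𝒯_hash`: under the hypotheses of
`advxxz2025_lemma55_exists`, some seed gives `7 |B| |𝒯α| ≤ 8 M² · |𝒯_hash|`.
[cite: AlmanDuanVassilevskaWilliamsXuXuZhou2025, Lemma 5.5 (3)] -/
theorem exists_seed_card_xPresentTriples (hM : M ≠ 2) (hPM : P < M) (hn : 0 < n) {μX μY μZ : Fin (P + 1) → ℕ}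
    (h8X : 8 * (typedSupport (levelSupport P) n μX μY μZ).card ≤ M * (typeClass n μX).card)
    {𝒯α : Finset ((Fin n → Fin (P + 1)) × (Fin n → Fin (P + 1)) × (Fin n → Fin (P + 1)))}
    (h𝒯α : 𝒯α ⊆ typedSupport (levelSupport P) n μX μY μZ) {B : Finset (ZMod M)}
    (hB : ThreeAPFree (B : Set (ZMod M))) :
    ∃ ω : VxxzSeed M n, 7 * (B.card * 𝒯α.card) ≤ 8 * M ^ 2 *
      (xPresentTriples P (typedSupport (levelSupport P) n μX μY μZ) 𝒯α ω B).card := by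
  obtain ⟨ω, hω⟩ := advxxz2025_lemma55_exists hM hPM hn h8X h𝒯α B
  exact ⟨ω, by rwa [xPresentTriples_eq_filter_xSurvives hM h𝒯α ω hB]⟩

end Present

end Literature.Computability.AlgebraicComplexity
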